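/-
Copyright (c) 2026 the pub-hodgecm-mathlib formalisation cell (harness21).  Prover seat hodgecm-mathlib-K2E1-p10 (g2), Track B ∕ K2-LIT (build stream 29),
h413 = `stmt-HodgeConjecture-24833`, route of record `HCCMUnconditional`, campaigns «EIS-R7-BL-SPH-2∕3»; dealer K2E1-plan (g6) deal (83) 2026-09-04T10:38:21Z
(«`hsym` PAYER `K2E1SphericalTransformSymmetryU` — rank-generic ρ₀: `ĥ z = ĥ (ρ₀ − z)` for `h ∈ C_c(G)` left-`K`-invariant»; consumers (RES) K2E4-p10 and (G1) K2E1-p13).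
-/
import Summits.HodgeConjecture.HodgeConjecture.Theorems.K2E1SphericalHeckeEigenSectionU2             -- ★ ℓ9 `integral_flatSectionU_mul_mul_eq` (Hecke eigen-identity), `differentiable_integral_mul_borelHeight_cpow` (ĥ entire), `norm_borelHeight_cpow`
import Summits.HodgeConjecture.HodgeConjecture.Theorems.K2E1MaassSelbergSphericalBracketsCMTwo         -- ★ the ℂ-scaling identity `∫ H(w₀vg)^w = c(w)·H(g)^{ρ₀−w}` at `N = 2` (brings the `N = 3` twin ★ `…CMThree`)
import Summits.HodgeConjecture.HodgeConjecture.Theorems.K2E1IntertwinedCoeffContinuousCMTwo            -- ★ `continuousOn_intertwiningIntegral_flatSectionU` (every rank), `integrable_borelHeight_weylLongU_mul_rpow_cm_two`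
import Summits.HodgeConjecture.HodgeConjecture.Theorems.K2E1IntertwinedCoeffContinuousCM               -- ★ `integrable_borelHeight_weylLongU_mul_rpow_cm_three`
import Summits.HodgeConjecture.HodgeConjecture.Theorems.K2E1SphericalEisensteinStructuralDataCMTwo      -- ★ p859399∕p859380 (this seat): the radical package `(ν, 𝓕)` inhabited at `N = 2, 3`
import HarnessLib

/-!
# h413 ∕ Track B «K2-LIT» — helper `K2E1SphericalTransformSymmetryU`: THE SPHERICAL TRANSFORM ALONG THE BOREL HEIGHT IS SYMMETRIC UNDER `z ↦ ρ₀ − z` —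
# `∫_G h(x)·H(x)^z dx = ∫_G h(x)·H(x)^{ρ₀−z} dx` for left-`K`-invariant `h ∈ C_c(G(𝔸))` (every rank from the intertwining scaling identity; letter-free at `U(1,1)` (`ρ₀ = 1`) and `U(2,1)` (`ρ₀ = 2`))

Cell `pub/hodgecm-mathlib`, crux h413 = `stmt-HodgeConjecture-24833`, route of record `HCCMUnconditional`; chair K2-lead (g1), dealer K2E1-plan (g6) deal (83) 2026-09-04T10:38:21Z and
ruling (85) (G1).  THEOREMS ONLY (no `def`, no `instance`, no notation, no named-fact hypothesis, no `sorry`); lane `--supports stmt-HodgeConjecture-24833 --as helper` (count-neutral).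
Closes no socket.  Two consumers: K2E4-p10's (RES) letter `hsym : Λ_g 𝟙 = ĥ(2)` (★ p859418, after `Λ_g 𝟙 = ∫ h`: the print `ĥ(2) = ∫ h` of §3) and K2E1-p13's T2′ (G1) `ĥ_i(1 − z) = ĥ_i(z)` (§2).

THE MATHEMATICS ([MoeglinWaldspurger1995, II.1.6–II.1.7, IV.1.10]; [Langlands1976, §6]; [Garrett2018, §2.8]).  `G = U(J_N)(𝔸_F)`, `H` the Borel height, `ν_G` a left Haar measure, `h ∈ C_c(G)`
LEFT-`K`-invariant, `ĥ(z) := ∫_G h(x)·H(x)^z dν_G(x)` (entire, ★ ℓ9 (a)).  Two operators act on the flat section `H^w`: the right convolution `R(h)`, by the scalar `ĥ(w)` (★ ℓ9 (b):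
`∫_G h(y)·H(x y)^w dy = ĥ(w)·H(x)^w`), and the standard intertwining integral `M(w)`, by `H^w ↦ c(w)·H^{ρ₀−w}` (★ the scaling identity `∫_{N(𝔸)} H(w₀ v g)^w dν(v) = c(w)·H(g)^{ρ₀−w}`,
`c(w) := ∫_{N(𝔸)} H(w₀ v)^w dν(v)`, EVERY `w`, no convergence hypothesis — ★ `integral_borelHeight_weylLongU_mul_cpow_eq` at `N = 2` (`ρ₀ = 1`) and `N = 3` (`ρ₀ = 2`)).  They COMMUTE
(Fubini on `G × N(𝔸)`, legitimate for `Re w > ρ₀` where `v ↦ H(w₀ v g)^{Re w} ∈ L¹(ν)`, ★ `hint`): `c(w)·ĥ(ρ₀ − w) = ∫_G h(y)·c(w)H(y)^{ρ₀−w} dy = ∫_G h(y) ∫_N H(w₀ v y)^w dν dy = ∫_N ∫_G h(y)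
H(w₀v·y)^w dy dν = ∫_N ĥ(w)·H(w₀ v)^w dν = ĥ(w)·c(w)` (§1 `…_mul_intertwining_eq_of_scaling`).  Since `c` is continuous on `{Re w > ρ₀}` (★ `continuousOn_intertwiningIntegral_flatSectionU`)
and `c(σ) > 0` for real `σ > ρ₀` (positive integrand, Haar `ν`), `ĥ(w) = ĥ(ρ₀ − w)` on a non-empty open set, hence on all of `ℂ` by the identity principle (both sides entire) — §1
`integral_mul_borelHeight_cpow_symm_of_scaling`.  §2∕§3 discharge every letter at the CM pair (Iwasawa ★, `conj² = 1 ≠ conj`, `(ν, 𝓕)` ★ p859399∕p859380, `hint` ★, `c(σ) > 0`).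

* §1 (every rank, abstract `ρ₀ : ℝ`, letters `hscale`∕`hint`∕`hc`): `integral_mul_borelHeight_mul_cpow_eq` (ℓ9 (b)), **`integral_mul_intertwining_eq_of_scaling`**, **`integral_mul_borelHeight_cpow_symm_of_scaling`**.
* §2 `U(1,1)_{L∕L⁺}` (`ρ₀ = 1`, letter-free): **`sphericalTransform_symm_cm_two`** (`ĥ(z) = ĥ(1 − z)`), **`integral_mul_borelHeight_eq_integral_cm_two`** (`ĥ(1) = ∫ h`).
* §3 `U(2,1)_{L∕L⁺}` (`ρ₀ = 2`, letter-free): **`sphericalTransform_symm_cm_three`** (`ĥ(z) = ĥ(2 − z)`), **`integral_mul_borelHeight_sq_eq_integral_cm_three`** (`ĥ(2) = ∫ h`, K2E4-p10's `hsym`).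

HONEST LABEL: HC_CM is proved only modulo the 7 printed citations (2 remaining named inputs: hLiu418 = `stmt-HodgeConjecture-24832`, h413 = `stmt-HodgeConjecture-24833`) until rung 0
closes; this file asserts no named fact and closes no socket.
References: [MoeglinWaldspurger1995] II.1.6–II.1.7, IV.1.10; [Langlands1976] LNM 544, §6; [Garrett2018] P. Garrett, *Modern Analysis of Automorphic Forms by Example*, §2.8, §11.3.
-/

set_option autoImplicit false
-- the mandated namespace repeats `HodgeConjecture.HodgeConjecture`, as in every `Theorems/*.lean` of this sub-problem
set_option linter.dupNamespace false

noncomputable section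

open MeasureTheory MeasureTheory.Measure Set NumberField Filter Topology Function
open scoped NNReal ENNReal
open Literature.MeasureTheory.Group Literature.NumberTheory.Automorphic Literature.NumberTheory.Automorphic.UnitaryGroup AdelicGroupData
open Summit.HodgeConjecture.HodgeConjecture.Cruxes.H413.K2E1BorelEisensteinU
open Summit.HodgeConjecture.HodgeConjecture.Cruxes.H413.K2E1SphericalHeckeEigenSectionU2 (integral_flatSectionU_mul_mul_eq differentiable_integral_mul_borelHeight_cpow
  norm_borelHeight_cpow continuous_borelHeight_cpow continuous_borelHeight_coe borelHeight_coe_pos)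
open Summit.HodgeConjecture.HodgeConjecture.Cruxes.H413.K2E1IntertwinedCoeffContinuousCMTwo (continuousOn_intertwiningIntegral_flatSectionU integrable_borelHeight_weylLongU_mul_rpow_cm_two)
open Summit.HodgeConjecture.HodgeConjecture.Cruxes.H413.K2E1IntertwinedCoeffContinuousCM (integrable_borelHeight_weylLongU_mul_rpow_cm_three)
open Summit.HodgeConjecture.HodgeConjecture.Cruxes.H413.K2E1HeisenbergHaarU3 (locallyCompactSpace_and_secondCountableTopology_adelicUnipotent)
open Summit.HodgeConjecture.HodgeConjecture.Cruxes.H413.K2E1SphericalEisensteinStructuralDataCMTwo (exists_unipotent_haar_fundamentalDomain_cm_two)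
open Summit.HodgeConjecture.HodgeConjecture.Cruxes.H413.K2E1SphericalEisensteinStructuralDataCMThree (exists_unipotent_haar_fundamentalDomain_cm_three)

namespace Summit.HodgeConjecture.HodgeConjecture.Cruxes.H413.K2E1SphericalTransformSymmetryU

/-! ## §1 Every rank: the commutation `ĥ(w)·c(w) = c(w)·ĥ(ρ₀ − w)` and the symmetry `ĥ(z) = ĥ(ρ₀ − z)` from the scaling identity -/

section Generic

variable {F E : Type} [Field F] [NumberField F] [Field E] [NumberField E] [Algebra F E] {c : E ≃ₐ[F] E} {N : ℕ} [NeZero N]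
  [MeasurableSpace (quasiSplit F E c N).Adelic] [BorelSpace (quasiSplit F E c N).Adelic]

/-- **ℓ9 (b) in the spelling `∫_G h(y)·H(x·y)^w dν_G(y) = ĥ(w)·H(x)^w`** (every `x`, every `w`; `h` left-`K`-invariant, `ν_G` left-invariant, Iwasawa letter `hBK`) — ★
`integral_flatSectionU_mul_mul_eq` at `φ₀ = 1`. [cite: Langlands1976, §6 p. 167] [cite: MoeglinWaldspurger1995, II.1.2] -/
theorem integral_mul_borelHeight_mul_cpow_eq (νG : Measure (quasiSplit F E c N).Adelic) [νG.IsMulLeftInvariant]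
    (hBK : ∀ g : (quasiSplit F E c N).Adelic, ∃ b ∈ borelAdelic F E c N, ∃ k : (quasiSplit F E c N).Adelic,
      adelicVal F E c N ((StdForm.antidiagonal N).over E) k ∈ standardMaximalCompactGL N E ∧ g = b * k)
    {h : (quasiSplit F E c N).Adelic → ℂ}
    (hK : ∀ k : (quasiSplit F E c N).Adelic, adelicVal F E c N ((StdForm.antidiagonal N).over E) k ∈ standardMaximalCompactGL N E → ∀ x, h (k * x) = h x)
    (w : ℂ) (x : (quasiSplit F E c N).Adelic) :
    ∫ y, h y * (((borelHeight (x * y) : ℝ≥0) : ℝ) : ℂ) ^ w ∂νG = (∫ y, h y * (((borelHeight y : ℝ≥0) : ℝ) : ℂ) ^ w ∂νG) * (((borelHeight x : ℝ≥0) : ℝ) : ℂ) ^ w := by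
  have h1 := integral_flatSectionU_mul_mul_eq νG hBK hK 1 w x
  simp only [flatSectionU_apply, one_mul] at h1
  rw [← h1]
  exact integral_congr_ae (Eventually.of_forall fun y => mul_comm _ _)

/-- **`R(h)` AND THE STANDARD INTERTWINING INTEGRAL COMMUTE ON THE FLAT SECTION: `ĥ(w)·c(w) = c(w)·ĥ(ρ₀ − w)`** (every rank; `c(w) = ∫_{N(𝔸)} H(w₀ v)^w dν`).  Letters: the scaling identity
`hscale : ∫_N H(w₀ v g)^w dν = c(w)·H(g)^{ρ₀−w}` (★ at `N = 2, 3`), the Iwasawa decomposition `hBK` (★ at the CM pair), and `hintw : v ↦ H(w₀ v g)^{Re w} ∈ L¹(ν)` for every `g` (★ at the CM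
pair for `Re w > ρ₀`).  Proof: `c(w)·ĥ(ρ₀−w) = ∫_G h(y)·(∫_N H(w₀vy)^w dν) dy` (`hscale`, pointwise) `= ∫_N (∫_G h(y)·H(w₀v·y)^w dy) dν` (Fubini on `ν_G ⊗ ν`: the integrand is continuous, its fibres are
in `L¹(ν)` by `hintw`, and `y ↦ ∫_N ‖·‖ dν = ‖h(y)‖·c(Re w)·H(y)^{ρ₀−Re w}` is continuous with compact support) `= ∫_N ĥ(w)·H(w₀ v)^w dν = ĥ(w)·c(w)` (ℓ9 (b)).
[cite: MoeglinWaldspurger1995, II.1.6–II.1.7] [cite: Garrett2018, §2.8] [cite: Langlands1976, §6] -/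
theorem integral_mul_intertwining_eq_of_scaling (νG : Measure (quasiSplit F E c N).Adelic) [νG.IsMulLeftInvariant] [IsFiniteMeasureOnCompacts νG] [SFinite νG]
    (ν : Measure ↥(adelicUnipotent F E c N)) [SFinite ν] {ρ₀ : ℝ}
    (hscale : ∀ (w : ℂ) (g : (quasiSplit F E c N).Adelic),
      ∫ v : ↥(adelicUnipotent F E c N), (((borelHeight ((quasiSplit F E c N).toAdelic (weylLongU (c : E →+* E) (rfl : (StdForm.antidiagonal N).over E = (StdForm.antidiagonal N).over E)) *
          ((v : (quasiSplit F E c N).Adelic) * g)) : ℝ≥0) : ℝ) : ℂ) ^ w ∂ν =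
        (∫ v : ↥(adelicUnipotent F E c N), (((borelHeight ((quasiSplit F E c N).toAdelic (weylLongU (c : E →+* E) (rfl : (StdForm.antidiagonal N).over E = (StdForm.antidiagonal N).over E)) *
          (v : (quasiSplit F E c N).Adelic)) : ℝ≥0) : ℝ) : ℂ) ^ w ∂ν) * (((borelHeight g : ℝ≥0) : ℝ) : ℂ) ^ ((ρ₀ : ℂ) - w))
    (hBK : ∀ g : (quasiSplit F E c N).Adelic, ∃ b ∈ borelAdelic F E c N, ∃ k : (quasiSplit F E c N).Adelic,
      adelicVal F E c N ((StdForm.antidiagonal N).over E) k ∈ standardMaximalCompactGL N E ∧ g = b * k)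
    {h : (quasiSplit F E c N).Adelic → ℂ}
    (hK : ∀ k : (quasiSplit F E c N).Adelic, adelicVal F E c N ((StdForm.antidiagonal N).over E) k ∈ standardMaximalCompactGL N E → ∀ x, h (k * x) = h x)
    (hh : Continuous h) (hhs : HasCompactSupport h) {w : ℂ}
    (hintw : ∀ g : (quasiSplit F E c N).Adelic, Integrable (fun v : ↥(adelicUnipotent F E c N) =>
      ((borelHeight ((quasiSplit F E c N).toAdelic (weylLongU (c : E →+* E) (rfl : (StdForm.antidiagonal N).over E = (StdForm.antidiagonal N).over E)) *
        ((v : (quasiSplit F E c N).Adelic) * g)) : ℝ≥0) : ℝ) ^ w.re) ν) :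
    (∫ x, h x * (((borelHeight x : ℝ≥0) : ℝ) : ℂ) ^ w ∂νG) *
        (∫ v : ↥(adelicUnipotent F E c N), (((borelHeight ((quasiSplit F E c N).toAdelic (weylLongU (c : E →+* E) (rfl : (StdForm.antidiagonal N).over E = (StdForm.antidiagonal N).over E)) *
          (v : (quasiSplit F E c N).Adelic)) : ℝ≥0) : ℝ) : ℂ) ^ w ∂ν) =
      (∫ v : ↥(adelicUnipotent F E c N), (((borelHeight ((quasiSplit F E c N).toAdelic (weylLongU (c : E →+* E) (rfl : (StdForm.antidiagonal N).over E = (StdForm.antidiagonal N).over E)) *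
          (v : (quasiSplit F E c N).Adelic)) : ℝ≥0) : ℝ) : ℂ) ^ w ∂ν) *
        ∫ x, h x * (((borelHeight x : ℝ≥0) : ℝ) : ℂ) ^ ((ρ₀ : ℂ) - w) ∂νG := by
  haveI := t2Space_adeleRing_of_numberField E
  haveI := locallyCompactSpace_adeleRing' E
  haveI := secondCountableTopology_adeleRing E
  haveI : SecondCountableTopology (quasiSplit F E c N).Adelic := inferInstanceAs (SecondCountableTopology (adelic F E c N ((StdForm.antidiagonal N).over E)))
  obtain ⟨_, h₂⟩ := locallyCompactSpace_and_secondCountableTopology_adelicUnipotent (F := F) (E := E) (c := c) (N := N)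
  haveI := h₂
  set W : (quasiSplit F E c N).Adelic := (quasiSplit F E c N).toAdelic (weylLongU (c : E →+* E) (rfl : (StdForm.antidiagonal N).over E = (StdForm.antidiagonal N).over E)) with hW
  set cw : ℂ := ∫ v : ↥(adelicUnipotent F E c N), (((borelHeight (W * (v : (quasiSplit F E c N).Adelic)) : ℝ≥0) : ℝ) : ℂ) ^ w ∂ν with hcw
  set σ : ℝ := w.re with hσ
  set Φ : (quasiSplit F E c N).Adelic → ↥(adelicUnipotent F E c N) → ℂ := fun y v => h y * (((borelHeight (W * ((v : (quasiSplit F E c N).Adelic) * y)) : ℝ≥0) : ℝ) : ℂ) ^ w with hΦ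
  have hWc : Continuous fun p : (quasiSplit F E c N).Adelic × ↥(adelicUnipotent F E c N) => W * ((p.2 : (quasiSplit F E c N).Adelic) * p.1) :=
    continuous_const.mul ((continuous_subtype_val.comp continuous_snd).mul continuous_fst)
  have hΦc : Continuous (uncurry Φ) := (hh.comp continuous_fst).mul ((continuous_borelHeight_cpow w).comp hWc)
  have hΦm : AEStronglyMeasurable (uncurry Φ) (νG.prod ν) := hΦc.aestronglyMeasurable
  have hnorm : ∀ y (v : ↥(adelicUnipotent F E c N)), ‖Φ y v‖ = ‖h y‖ * ((borelHeight (W * ((v : (quasiSplit F E c N).Adelic) * y)) : ℝ≥0) : ℝ) ^ σ := fun y v => by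
    rw [hΦ]
    dsimp only
    rw [norm_mul, norm_borelHeight_cpow]
  have hfib : ∀ y, Integrable (Φ y) ν := fun y => by
    have hG : Integrable (fun v : ↥(adelicUnipotent F E c N) => (((borelHeight (W * ((v : (quasiSplit F E c N).Adelic) * y)) : ℝ≥0) : ℝ) : ℂ) ^ w) ν := by
      refine (hintw y).mono' ?_ (ae_of_all _ fun v => le_of_eq (norm_borelHeight_cpow _ w))
      exact ((continuous_borelHeight_cpow w).comp (continuous_const.mul (continuous_subtype_val.mul continuous_const))).aestronglyMeasurable
    exact hG.const_mul (h y)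
  -- the real scaling identity at `σ = Re w`: `∫_N H(w₀ v y)^σ dν = c(σ)·H(y)^{ρ₀−σ}`
  set cσ : ℝ := ∫ v : ↥(adelicUnipotent F E c N), ((borelHeight (W * (v : (quasiSplit F E c N).Adelic)) : ℝ≥0) : ℝ) ^ σ ∂ν with hcσ
  have hreal : ∀ y, ∫ v : ↥(adelicUnipotent F E c N), ((borelHeight (W * ((v : (quasiSplit F E c N).Adelic) * y)) : ℝ≥0) : ℝ) ^ σ ∂ν =
      cσ * ((borelHeight y : ℝ≥0) : ℝ) ^ (ρ₀ - σ) := fun y => by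
    have h1 := hscale (σ : ℂ) y
    have e1 : ∀ g : (quasiSplit F E c N).Adelic, (((borelHeight g : ℝ≥0) : ℝ) : ℂ) ^ (σ : ℂ) = ((((borelHeight g : ℝ≥0) : ℝ) ^ σ : ℝ) : ℂ) := fun g =>
      (Complex.ofReal_cpow (NNReal.coe_nonneg _) σ).symm
    have e2 : (((borelHeight y : ℝ≥0) : ℝ) : ℂ) ^ ((ρ₀ : ℂ) - (σ : ℂ)) = ((((borelHeight y : ℝ≥0) : ℝ) ^ (ρ₀ - σ) : ℝ) : ℂ) := by
      rw [← Complex.ofReal_sub]; exact (Complex.ofReal_cpow (NNReal.coe_nonneg _) _).symm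
    simp only [e1, e2] at h1
    exact_mod_cast h1
  -- `y ↦ ∫_N ‖Φ y v‖ dν` is continuous with compact support, hence integrable
  have hmaj : ∀ y, ∫ v, ‖Φ y v‖ ∂ν = ‖h y‖ * (cσ * ((borelHeight y : ℝ≥0) : ℝ) ^ (ρ₀ - σ)) := fun y => by
    simp only [hnorm]
    rw [integral_const_mul, hreal y]
  have hint2 : Integrable (fun y => ∫ v, ‖uncurry Φ (y, v)‖ ∂ν) νG := by
    have e : (fun y => ∫ v, ‖uncurry Φ (y, v)‖ ∂ν) = fun y => ‖h y‖ * (cσ * ((borelHeight y : ℝ≥0) : ℝ) ^ (ρ₀ - σ)) := funext fun y => hmaj y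
    rw [e]
    refine Continuous.integrable_of_hasCompactSupport ?_ hhs.norm.mul_right
    exact hh.norm.mul (continuous_const.mul (continuous_borelHeight_coe.rpow_const fun y => Or.inl (borelHeight_coe_pos y).ne'))
  have hΦint : Integrable (uncurry Φ) (νG.prod ν) := (integrable_prod_iff hΦm).2 ⟨ae_of_all _ fun y => hfib y, hint2⟩
  have hswap : ∫ y, ∫ v, Φ y v ∂ν ∂νG = ∫ v, ∫ y, Φ y v ∂νG ∂ν := integral_integral_swap hΦint
  -- the inner `G`-integral by ℓ9 (b) at `x = w₀ v`
  have hinner : ∀ v : ↥(adelicUnipotent F E c N), ∫ y, Φ y v ∂νG =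
      (∫ y, h y * (((borelHeight y : ℝ≥0) : ℝ) : ℂ) ^ w ∂νG) * (((borelHeight (W * (v : (quasiSplit F E c N).Adelic)) : ℝ≥0) : ℝ) : ℂ) ^ w := fun v => by
    simp only [hΦ, ← mul_assoc W]
    exact integral_mul_borelHeight_mul_cpow_eq νG hBK hK w _
  -- the outer `G`-integrand by `hscale`
  have houter : ∀ y, ∫ v, Φ y v ∂ν = h y * (cw * (((borelHeight y : ℝ≥0) : ℝ) : ℂ) ^ ((ρ₀ : ℂ) - w)) := fun y => by
    simp only [hΦ]
    rw [integral_const_mul, hscale w y]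
  calc (∫ x, h x * (((borelHeight x : ℝ≥0) : ℝ) : ℂ) ^ w ∂νG) * cw
      = ∫ v : ↥(adelicUnipotent F E c N), (∫ y, h y * (((borelHeight y : ℝ≥0) : ℝ) : ℂ) ^ w ∂νG) * (((borelHeight (W * (v : (quasiSplit F E c N).Adelic)) : ℝ≥0) : ℝ) : ℂ) ^ w ∂ν := by
        rw [hcw, integral_const_mul]
    _ = ∫ v, ∫ y, Φ y v ∂νG ∂ν := integral_congr_ae (Eventually.of_forall fun v => (hinner v).symm)
    _ = ∫ y, ∫ v, Φ y v ∂ν ∂νG := hswap.symm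
    _ = ∫ y, h y * (cw * (((borelHeight y : ℝ≥0) : ℝ) : ℂ) ^ ((ρ₀ : ℂ) - w)) ∂νG := integral_congr_ae (Eventually.of_forall fun y => houter y)
    _ = cw * ∫ x, h x * (((borelHeight x : ℝ≥0) : ℝ) : ℂ) ^ ((ρ₀ : ℂ) - w) ∂νG := by
        rw [← integral_const_mul]
        exact integral_congr_ae (Eventually.of_forall fun y => by ring)

/-- **THE SPHERICAL TRANSFORM IS SYMMETRIC: `ĥ(z) = ĥ(ρ₀ − z)` FOR EVERY `z : ℂ`** (every rank; `h ∈ C_c(G(𝔸))` left-`K`-invariant, `ν_G` a left Haar measure).  Letters: `hscale` (★ at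
`N = 2, 3`), `hint : v ↦ H(w₀ v g)^σ ∈ L¹(ν)` for real `σ > ρ₀` (★ at the CM pair), `hc : c(σ) ≠ 0` for some real `σ > ρ₀` (positive integrand), Iwasawa `hBK` (★).  From the commutation
`ĥ(w)c(w) = c(w)ĥ(ρ₀−w)` on `{Re w > ρ₀}` and the continuity of `c` there (★ `continuousOn_intertwiningIntegral_flatSectionU`), `ĥ = ĥ ∘ (ρ₀ − ·)` on the non-empty open set `{Re w > ρ₀, c(w) ≠ 0}`,
hence everywhere (identity principle; both sides entire ★). [cite: MoeglinWaldspurger1995, II.1.6–II.1.7 and IV.1.10] [cite: Garrett2018, §2.8] -/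
theorem integral_mul_borelHeight_cpow_symm_of_scaling (νG : Measure (quasiSplit F E c N).Adelic) [νG.IsMulLeftInvariant] [IsFiniteMeasureOnCompacts νG] [SFinite νG]
    (ν : Measure ↥(adelicUnipotent F E c N)) [SFinite ν] {ρ₀ : ℝ}
    (hscale : ∀ (w : ℂ) (g : (quasiSplit F E c N).Adelic),
      ∫ v : ↥(adelicUnipotent F E c N), (((borelHeight ((quasiSplit F E c N).toAdelic (weylLongU (c : E →+* E) (rfl : (StdForm.antidiagonal N).over E = (StdForm.antidiagonal N).over E)) *
          ((v : (quasiSplit F E c N).Adelic) * g)) : ℝ≥0) : ℝ) : ℂ) ^ w ∂ν =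
        (∫ v : ↥(adelicUnipotent F E c N), (((borelHeight ((quasiSplit F E c N).toAdelic (weylLongU (c : E →+* E) (rfl : (StdForm.antidiagonal N).over E = (StdForm.antidiagonal N).over E)) *
          (v : (quasiSplit F E c N).Adelic)) : ℝ≥0) : ℝ) : ℂ) ^ w ∂ν) * (((borelHeight g : ℝ≥0) : ℝ) : ℂ) ^ ((ρ₀ : ℂ) - w))
    (hint : ∀ σ : ℝ, ρ₀ < σ → ∀ g : (quasiSplit F E c N).Adelic, Integrable (fun v : ↥(adelicUnipotent F E c N) =>
      ((borelHeight ((quasiSplit F E c N).toAdelic (weylLongU (c : E →+* E) (rfl : (StdForm.antidiagonal N).over E = (StdForm.antidiagonal N).over E)) *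
        ((v : (quasiSplit F E c N).Adelic) * g)) : ℝ≥0) : ℝ) ^ σ) ν)
    (hc : ∃ σ : ℝ, ρ₀ < σ ∧ (∫ v : ↥(adelicUnipotent F E c N), (((borelHeight ((quasiSplit F E c N).toAdelic (weylLongU (c : E →+* E) (rfl : (StdForm.antidiagonal N).over E = (StdForm.antidiagonal N).over E)) *
          (v : (quasiSplit F E c N).Adelic)) : ℝ≥0) : ℝ) : ℂ) ^ (σ : ℂ) ∂ν) ≠ 0)
    (hBK : ∀ g : (quasiSplit F E c N).Adelic, ∃ b ∈ borelAdelic F E c N, ∃ k : (quasiSplit F E c N).Adelic,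
      adelicVal F E c N ((StdForm.antidiagonal N).over E) k ∈ standardMaximalCompactGL N E ∧ g = b * k)
    {h : (quasiSplit F E c N).Adelic → ℂ}
    (hK : ∀ k : (quasiSplit F E c N).Adelic, adelicVal F E c N ((StdForm.antidiagonal N).over E) k ∈ standardMaximalCompactGL N E → ∀ x, h (k * x) = h x)
    (hh : Continuous h) (hhs : HasCompactSupport h) (z : ℂ) :
    ∫ x, h x * (((borelHeight x : ℝ≥0) : ℝ) : ℂ) ^ z ∂νG = ∫ x, h x * (((borelHeight x : ℝ≥0) : ℝ) : ℂ) ^ ((ρ₀ : ℂ) - z) ∂νG := by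
  set W : (quasiSplit F E c N).Adelic := (quasiSplit F E c N).toAdelic (weylLongU (c : E →+* E) (rfl : (StdForm.antidiagonal N).over E = (StdForm.antidiagonal N).over E)) with hW
  set T : ℂ → ℂ := fun w => ∫ x, h x * (((borelHeight x : ℝ≥0) : ℝ) : ℂ) ^ w ∂νG with hT
  have hTd : Differentiable ℂ T := differentiable_integral_mul_borelHeight_cpow νG hh hhs
  have hTd' : Differentiable ℂ (fun w => T ((ρ₀ : ℂ) - w)) := hTd.comp ((differentiable_const _).sub differentiable_id)
  -- the scalar `c` and its continuity on `{Re w > ρ₀}`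
  set cf : ℂ → ℂ := fun w => ∫ v : ↥(adelicUnipotent F E c N), (((borelHeight (W * (v : (quasiSplit F E c N).Adelic)) : ℝ≥0) : ℝ) : ℂ) ^ w ∂ν with hcf
  have hint1 : ∀ σ : ℝ, ρ₀ < σ → Integrable (fun v : ↥(adelicUnipotent F E c N) => ((borelHeight (W * ((v : (quasiSplit F E c N).Adelic) * 1)) : ℝ≥0) : ℝ) ^ σ) ν :=
    fun σ hσ => hint σ hσ 1
  have hcont0 := continuousOn_intertwiningIntegral_flatSectionU ν (φ := fun _ : (quasiSplit F E c N).Adelic => (1 : ℂ)) measurable_const (Cφ := 1)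
    (fun _ => by rw [norm_one]) (1 : (quasiSplit F E c N).Adelic) hint1
  have hcont : ContinuousOn cf {w : ℂ | ρ₀ < w.re} := by
    refine hcont0.congr fun w _ => ?_
    simp only [hcf, hW, flatSectionU_apply, one_mul, mul_one]
  -- the good set `U = {Re w > ρ₀} ∩ {c ≠ 0}` is open and non-empty
  set U : Set ℂ := {w : ℂ | ρ₀ < w.re} ∩ cf ⁻¹' {0}ᶜ with hU
  have hUo : IsOpen U := hcont.isOpen_inter_preimage (isOpen_lt continuous_const Complex.continuous_re) isOpen_compl_singleton
  obtain ⟨σ₁, hσ₁, hcσ₁⟩ := hc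
  have hσ₁U : (σ₁ : ℂ) ∈ U := ⟨by simpa only [mem_setOf_eq, Complex.ofReal_re] using hσ₁, hcσ₁⟩
  -- on `U` the two functions agree
  have hUeq : ∀ w ∈ U, T w = T ((ρ₀ : ℂ) - w) := by
    intro w hw
    have hw1 : ρ₀ < w.re := hw.1
    have hw2 : cf w ≠ 0 := hw.2
    have key := integral_mul_intertwining_eq_of_scaling νG ν hscale hBK hK hh hhs (w := w) (hint w.re hw1)
    have key' : T w * cf w = T ((ρ₀ : ℂ) - w) * cf w := by rw [key, mul_comm]
    exact mul_right_cancel₀ hw2 key'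
  -- identity principle
  have hTeq : T = fun w => T ((ρ₀ : ℂ) - w) :=
    AnalyticOnNhd.eq_of_eventuallyEq (hTd.differentiableOn.analyticOnNhd isOpen_univ) (hTd'.differentiableOn.analyticOnNhd isOpen_univ)
      (eventuallyEq_of_mem (hUo.mem_nhds hσ₁U) hUeq)
  exact congrFun hTeq z

end Generic

/-! ## §2 `U(1,1)_{L∕L⁺}` (`ρ₀ = 1`): every letter discharged -/

section CMTwo

variable (L : Type) [Field L] [NumberField L] [IsCMField L]
  [MeasurableSpace (quasiSplit (↥(maximalRealSubfield L)) L (IsCMField.complexConj L) 2).Adelic] [BorelSpace (quasiSplit (↥(maximalRealSubfield L)) L (IsCMField.complexConj L) 2).Adelic]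

/-- **`ĥ(z) = ĥ(1 − z)` ON `U(1,1)_{L∕L⁺}`, LETTER-FREE**: for every Haar measure `ν_G` of `G(𝔸)`, every left-`K`-invariant `h ∈ C_c(G(𝔸))` and every `z : ℂ`,
`∫ h(x)·H(x)^z dν_G = ∫ h(x)·H(x)^{1−z} dν_G` — §1 with `hscale` ★ `K2E1MaassSelbergSphericalBracketsCMTwo.integral_borelHeight_weylLongU_mul_cpow_eq`, `hint` ★
`integrable_borelHeight_weylLongU_mul_rpow_cm_two` over the radical package ★ `exists_unipotent_haar_fundamentalDomain_cm_two`, `c(2) > 0`, Iwasawa ★.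
[cite: MoeglinWaldspurger1995, II.1.6–II.1.7 and IV.1.10] [cite: Garrett2018, §2.8] -/
theorem sphericalTransform_symm_cm_two (νG : Measure (quasiSplit (↥(maximalRealSubfield L)) L (IsCMField.complexConj L) 2).Adelic) [νG.IsHaarMeasure]
    {h : (quasiSplit (↥(maximalRealSubfield L)) L (IsCMField.complexConj L) 2).Adelic → ℂ}
    (hK : ∀ k : (quasiSplit (↥(maximalRealSubfield L)) L (IsCMField.complexConj L) 2).Adelic,
      adelicVal (↥(maximalRealSubfield L)) L (IsCMField.complexConj L) 2 ((StdForm.antidiagonal 2).over L) k ∈ standardMaximalCompactGL 2 L → ∀ x, h (k * x) = h x)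
    (hh : Continuous h) (hhs : HasCompactSupport h) (z : ℂ) :
    ∫ x, h x * (((borelHeight x : ℝ≥0) : ℝ) : ℂ) ^ z ∂νG = ∫ x, h x * (((borelHeight x : ℝ≥0) : ℝ) : ℂ) ^ (1 - z) ∂νG := by
  have hc : IsCMField.complexConj L * IsCMField.complexConj L = 1 := AlgEquiv.ext fun x => IsCMField.complexConj_apply_apply L x
  have hc1 : IsCMField.complexConj L ≠ 1 := IsCMField.complexConj_ne_one L
  haveI := t2Space_adeleRing_of_numberField L
  haveI := locallyCompactSpace_adeleRing' L
  haveI := secondCountableTopology_adeleRing L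
  haveI : SecondCountableTopology (quasiSplit (↥(maximalRealSubfield L)) L (IsCMField.complexConj L) 2).Adelic :=
    inferInstanceAs (SecondCountableTopology (adelic (↥(maximalRealSubfield L)) L (IsCMField.complexConj L) 2 ((StdForm.antidiagonal 2).over L)))
  haveI : LocallyCompactSpace (quasiSplit (↥(maximalRealSubfield L)) L (IsCMField.complexConj L) 2).Adelic :=
    inferInstanceAs (LocallyCompactSpace (adelic (↥(maximalRealSubfield L)) L (IsCMField.complexConj L) 2 ((StdForm.antidiagonal 2).over L)))
  obtain ⟨h₁, h₂⟩ := locallyCompactSpace_and_secondCountableTopology_adelicUnipotent (F := ↥(maximalRealSubfield L)) (E := L) (c := IsCMField.complexConj L) (N := 2)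
  haveI := h₁
  haveI := h₂
  obtain ⟨ν, 𝓕, hν, _, hνi, h𝓕N, h𝓕c, -, -⟩ := exists_unipotent_haar_fundamentalDomain_cm_two L
  haveI := hν
  haveI := hνi
  have hBK := exists_mem_borelAdelic_mul_mem_standardMaximalCompactGL_cm L (N := 2)
  have hscale := K2E1MaassSelbergSphericalBracketsCMTwo.integral_borelHeight_weylLongU_mul_cpow_eq hc hc1 ν hBK
  have hint : ∀ σ : ℝ, (1 : ℝ) < σ → ∀ g : (quasiSplit (↥(maximalRealSubfield L)) L (IsCMField.complexConj L) 2).Adelic,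
      Integrable (fun v : ↥(adelicUnipotent (↥(maximalRealSubfield L)) L (IsCMField.complexConj L) 2) =>
        ((borelHeight ((quasiSplit (↥(maximalRealSubfield L)) L (IsCMField.complexConj L) 2).toAdelic
          (weylLongU ((IsCMField.complexConj L : L ≃ₐ[↥(maximalRealSubfield L)] L) : L →+* L) (rfl : (StdForm.antidiagonal 2).over L = (StdForm.antidiagonal 2).over L)) *
            ((v : (quasiSplit (↥(maximalRealSubfield L)) L (IsCMField.complexConj L) 2).Adelic) * g)) : ℝ≥0) : ℝ) ^ σ) ν :=
    fun σ hσ g => integrable_borelHeight_weylLongU_mul_rpow_cm_two L ν h𝓕N h𝓕c hσ g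
  -- `c(2) > 0`: a positive continuous integrable function has positive integral for a Haar measure
  have hpos : ∃ σ : ℝ, (1 : ℝ) < σ ∧ (∫ v : ↥(adelicUnipotent (↥(maximalRealSubfield L)) L (IsCMField.complexConj L) 2),
      (((borelHeight ((quasiSplit (↥(maximalRealSubfield L)) L (IsCMField.complexConj L) 2).toAdelic
        (weylLongU ((IsCMField.complexConj L : L ≃ₐ[↥(maximalRealSubfield L)] L) : L →+* L) (rfl : (StdForm.antidiagonal 2).over L = (StdForm.antidiagonal 2).over L)) *
          (v : (quasiSplit (↥(maximalRealSubfield L)) L (IsCMField.complexConj L) 2).Adelic)) : ℝ≥0) : ℝ) : ℂ) ^ ((σ : ℝ) : ℂ) ∂ν) ≠ 0 := by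
    refine ⟨2, by norm_num, ?_⟩
    have hI := hint 2 (by norm_num) 1
    simp only [mul_one] at hI
    have e1 : ∀ v : ↥(adelicUnipotent (↥(maximalRealSubfield L)) L (IsCMField.complexConj L) 2),
        (((borelHeight ((quasiSplit (↥(maximalRealSubfield L)) L (IsCMField.complexConj L) 2).toAdelic
          (weylLongU ((IsCMField.complexConj L : L ≃ₐ[↥(maximalRealSubfield L)] L) : L →+* L) (rfl : (StdForm.antidiagonal 2).over L = (StdForm.antidiagonal 2).over L)) *
            (v : (quasiSplit (↥(maximalRealSubfield L)) L (IsCMField.complexConj L) 2).Adelic)) : ℝ≥0) : ℝ) : ℂ) ^ ((2 : ℝ) : ℂ) =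
        ((((borelHeight ((quasiSplit (↥(maximalRealSubfield L)) L (IsCMField.complexConj L) 2).toAdelic
          (weylLongU ((IsCMField.complexConj L : L ≃ₐ[↥(maximalRealSubfield L)] L) : L →+* L) (rfl : (StdForm.antidiagonal 2).over L = (StdForm.antidiagonal 2).over L)) *
            (v : (quasiSplit (↥(maximalRealSubfield L)) L (IsCMField.complexConj L) 2).Adelic)) : ℝ≥0) : ℝ) ^ (2 : ℝ) : ℝ) : ℂ) := fun v =>
      (Complex.ofReal_cpow (NNReal.coe_nonneg _) 2).symm
    simp only [e1, integral_complex_ofReal, ne_eq, Complex.ofReal_eq_zero]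
    refine ne_of_gt ((integral_pos_iff_support_of_nonneg (fun v => Real.rpow_nonneg (NNReal.coe_nonneg _) _) hI).2 ?_)
    have hsupp : Function.support (fun v : ↥(adelicUnipotent (↥(maximalRealSubfield L)) L (IsCMField.complexConj L) 2) =>
        ((borelHeight ((quasiSplit (↥(maximalRealSubfield L)) L (IsCMField.complexConj L) 2).toAdelic
          (weylLongU ((IsCMField.complexConj L : L ≃ₐ[↥(maximalRealSubfield L)] L) : L →+* L) (rfl : (StdForm.antidiagonal 2).over L = (StdForm.antidiagonal 2).over L)) *
            (v : (quasiSplit (↥(maximalRealSubfield L)) L (IsCMField.complexConj L) 2).Adelic)) : ℝ≥0) : ℝ) ^ (2 : ℝ)) = univ :=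
      Function.support_eq_univ fun v => (Real.rpow_pos_of_pos (borelHeight_coe_pos _) _).ne'
    rw [hsupp]
    exact isOpen_univ.measure_pos ν univ_nonempty
  have hmain := integral_mul_borelHeight_cpow_symm_of_scaling νG ν (ρ₀ := 1) (fun w g => by rw [Complex.ofReal_one]; exact hscale w g) hint
    hpos hBK hK hh hhs z
  simpa only [Complex.ofReal_one] using hmain

/-- **`ĥ(1) = ĥ(0) = ∫ h` ON `U(1,1)_{L∕L⁺}`**: `∫ h(x)·H(x) dν_G = ∫ h dν_G` for left-`K`-invariant `h ∈ C_c(G(𝔸))` (§2 at `z = 1`, `H^0 = 1`) — the (RES)-type print at `2ρ_H = 1`.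
[cite: MoeglinWaldspurger1995, II.1.7 and IV.1.11] [cite: Langlands1976, §7] -/
theorem integral_mul_borelHeight_eq_integral_cm_two (νG : Measure (quasiSplit (↥(maximalRealSubfield L)) L (IsCMField.complexConj L) 2).Adelic) [νG.IsHaarMeasure]
    {h : (quasiSplit (↥(maximalRealSubfield L)) L (IsCMField.complexConj L) 2).Adelic → ℂ}
    (hK : ∀ k : (quasiSplit (↥(maximalRealSubfield L)) L (IsCMField.complexConj L) 2).Adelic,
      adelicVal (↥(maximalRealSubfield L)) L (IsCMField.complexConj L) 2 ((StdForm.antidiagonal 2).over L) k ∈ standardMaximalCompactGL 2 L → ∀ x, h (k * x) = h x)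
    (hh : Continuous h) (hhs : HasCompactSupport h) :
    ∫ x, h x * (((borelHeight x : ℝ≥0) : ℝ) : ℂ) ^ (1 : ℂ) ∂νG = ∫ x, h x ∂νG := by
  rw [sphericalTransform_symm_cm_two L νG hK hh hhs 1, sub_self]
  simp only [Complex.cpow_zero, mul_one]

end CMTwo

/-! ## §3 `U(2,1)_{L∕L⁺}` (`ρ₀ = 2`): every letter discharged -/

section CMThree

variable (L : Type) [Field L] [NumberField L] [IsCMField L]
  [MeasurableSpace (quasiSplit (↥(maximalRealSubfield L)) L (IsCMField.complexConj L) 3).Adelic] [BorelSpace (quasiSplit (↥(maximalRealSubfield L)) L (IsCMField.complexConj L) 3).Adelic]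

/-- **`ĥ(z) = ĥ(2 − z)` ON `U(2,1)_{L∕L⁺}`, LETTER-FREE**: for every Haar measure `ν_G` of `G(𝔸)`, every left-`K`-invariant `h ∈ C_c(G(𝔸))` and every `z : ℂ`,
`∫ h(x)·H(x)^z dν_G = ∫ h(x)·H(x)^{2−z} dν_G` — §1 with `hscale` ★ `K2E1MaassSelbergSphericalBracketsCMThree.integral_borelHeight_weylLongU_mul_cpow_eq`, `hint` ★
`integrable_borelHeight_weylLongU_mul_rpow_cm_three` over the Heisenberg-radical package ★ `exists_unipotent_haar_fundamentalDomain_cm_three`, `c(3) > 0`, Iwasawa ★.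
[cite: MoeglinWaldspurger1995, II.1.6–II.1.7 and IV.1.10] [cite: Garrett2018, §2.8] -/
theorem sphericalTransform_symm_cm_three (νG : Measure (quasiSplit (↥(maximalRealSubfield L)) L (IsCMField.complexConj L) 3).Adelic) [νG.IsHaarMeasure]
    {h : (quasiSplit (↥(maximalRealSubfield L)) L (IsCMField.complexConj L) 3).Adelic → ℂ}
    (hK : ∀ k : (quasiSplit (↥(maximalRealSubfield L)) L (IsCMField.complexConj L) 3).Adelic,
      adelicVal (↥(maximalRealSubfield L)) L (IsCMField.complexConj L) 3 ((StdForm.antidiagonal 3).over L) k ∈ standardMaximalCompactGL 3 L → ∀ x, h (k * x) = h x)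
    (hh : Continuous h) (hhs : HasCompactSupport h) (z : ℂ) :
    ∫ x, h x * (((borelHeight x : ℝ≥0) : ℝ) : ℂ) ^ z ∂νG = ∫ x, h x * (((borelHeight x : ℝ≥0) : ℝ) : ℂ) ^ (2 - z) ∂νG := by
  have hc : IsCMField.complexConj L * IsCMField.complexConj L = 1 := AlgEquiv.ext fun x => IsCMField.complexConj_apply_apply L x
  have hc1 : IsCMField.complexConj L ≠ 1 := IsCMField.complexConj_ne_one L
  haveI := t2Space_adeleRing_of_numberField L
  haveI := locallyCompactSpace_adeleRing' L
  haveI := secondCountableTopology_adeleRing L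
  haveI : SecondCountableTopology (quasiSplit (↥(maximalRealSubfield L)) L (IsCMField.complexConj L) 3).Adelic :=
    inferInstanceAs (SecondCountableTopology (adelic (↥(maximalRealSubfield L)) L (IsCMField.complexConj L) 3 ((StdForm.antidiagonal 3).over L)))
  haveI : LocallyCompactSpace (quasiSplit (↥(maximalRealSubfield L)) L (IsCMField.complexConj L) 3).Adelic :=
    inferInstanceAs (LocallyCompactSpace (adelic (↥(maximalRealSubfield L)) L (IsCMField.complexConj L) 3 ((StdForm.antidiagonal 3).over L)))
  obtain ⟨h₁, h₂⟩ := locallyCompactSpace_and_secondCountableTopology_adelicUnipotent (F := ↥(maximalRealSubfield L)) (E := L) (c := IsCMField.complexConj L) (N := 3)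
  haveI := h₁
  haveI := h₂
  obtain ⟨ν, 𝓕, hν, _, hνi, h𝓕N, h𝓕c, -, -⟩ := exists_unipotent_haar_fundamentalDomain_cm_three L
  haveI := hν
  haveI := hνi
  have hBK := exists_mem_borelAdelic_mul_mem_standardMaximalCompactGL_cm L (N := 3)
  have hscale := K2E1MaassSelbergSphericalBracketsCMThree.integral_borelHeight_weylLongU_mul_cpow_eq hc hc1 ν hBK
  have hint : ∀ σ : ℝ, (2 : ℝ) < σ → ∀ g : (quasiSplit (↥(maximalRealSubfield L)) L (IsCMField.complexConj L) 3).Adelic,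
      Integrable (fun v : ↥(adelicUnipotent (↥(maximalRealSubfield L)) L (IsCMField.complexConj L) 3) =>
        ((borelHeight ((quasiSplit (↥(maximalRealSubfield L)) L (IsCMField.complexConj L) 3).toAdelic
          (weylLongU ((IsCMField.complexConj L : L ≃ₐ[↥(maximalRealSubfield L)] L) : L →+* L) (rfl : (StdForm.antidiagonal 3).over L = (StdForm.antidiagonal 3).over L)) *
            ((v : (quasiSplit (↥(maximalRealSubfield L)) L (IsCMField.complexConj L) 3).Adelic) * g)) : ℝ≥0) : ℝ) ^ σ) ν :=
    fun σ hσ g => integrable_borelHeight_weylLongU_mul_rpow_cm_three L ν h𝓕N h𝓕c hσ g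
  -- `c(3) > 0`
  have hpos : ∃ σ : ℝ, (2 : ℝ) < σ ∧ (∫ v : ↥(adelicUnipotent (↥(maximalRealSubfield L)) L (IsCMField.complexConj L) 3),
      (((borelHeight ((quasiSplit (↥(maximalRealSubfield L)) L (IsCMField.complexConj L) 3).toAdelic
        (weylLongU ((IsCMField.complexConj L : L ≃ₐ[↥(maximalRealSubfield L)] L) : L →+* L) (rfl : (StdForm.antidiagonal 3).over L = (StdForm.antidiagonal 3).over L)) *
          (v : (quasiSplit (↥(maximalRealSubfield L)) L (IsCMField.complexConj L) 3).Adelic)) : ℝ≥0) : ℝ) : ℂ) ^ ((σ : ℝ) : ℂ) ∂ν) ≠ 0 := by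
    refine ⟨3, by norm_num, ?_⟩
    have hI := hint 3 (by norm_num) 1
    simp only [mul_one] at hI
    have e1 : ∀ v : ↥(adelicUnipotent (↥(maximalRealSubfield L)) L (IsCMField.complexConj L) 3),
        (((borelHeight ((quasiSplit (↥(maximalRealSubfield L)) L (IsCMField.complexConj L) 3).toAdelic
          (weylLongU ((IsCMField.complexConj L : L ≃ₐ[↥(maximalRealSubfield L)] L) : L →+* L) (rfl : (StdForm.antidiagonal 3).over L = (StdForm.antidiagonal 3).over L)) *
            (v : (quasiSplit (↥(maximalRealSubfield L)) L (IsCMField.complexConj L) 3).Adelic)) : ℝ≥0) : ℝ) : ℂ) ^ ((3 : ℝ) : ℂ) =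
        ((((borelHeight ((quasiSplit (↥(maximalRealSubfield L)) L (IsCMField.complexConj L) 3).toAdelic
          (weylLongU ((IsCMField.complexConj L : L ≃ₐ[↥(maximalRealSubfield L)] L) : L →+* L) (rfl : (StdForm.antidiagonal 3).over L = (StdForm.antidiagonal 3).over L)) *
            (v : (quasiSplit (↥(maximalRealSubfield L)) L (IsCMField.complexConj L) 3).Adelic)) : ℝ≥0) : ℝ) ^ (3 : ℝ) : ℝ) : ℂ) := fun v =>
      (Complex.ofReal_cpow (NNReal.coe_nonneg _) 3).symm
    simp only [e1, integral_complex_ofReal, ne_eq, Complex.ofReal_eq_zero]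
    refine ne_of_gt ((integral_pos_iff_support_of_nonneg (fun v => Real.rpow_nonneg (NNReal.coe_nonneg _) _) hI).2 ?_)
    have hsupp : Function.support (fun v : ↥(adelicUnipotent (↥(maximalRealSubfield L)) L (IsCMField.complexConj L) 3) =>
        ((borelHeight ((quasiSplit (↥(maximalRealSubfield L)) L (IsCMField.complexConj L) 3).toAdelic
          (weylLongU ((IsCMField.complexConj L : L ≃ₐ[↥(maximalRealSubfield L)] L) : L →+* L) (rfl : (StdForm.antidiagonal 3).over L = (StdForm.antidiagonal 3).over L)) *
            (v : (quasiSplit (↥(maximalRealSubfield L)) L (IsCMField.complexConj L) 3).Adelic)) : ℝ≥0) : ℝ) ^ (3 : ℝ)) = univ :=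
      Function.support_eq_univ fun v => (Real.rpow_pos_of_pos (borelHeight_coe_pos _) _).ne'
    rw [hsupp]
    exact isOpen_univ.measure_pos ν univ_nonempty
  have hmain := integral_mul_borelHeight_cpow_symm_of_scaling νG ν (ρ₀ := 2) (fun w g => by rw [Complex.ofReal_ofNat]; exact hscale w g) hint
    hpos hBK hK hh hhs z
  simpa only [Complex.ofReal_ofNat] using hmain

/-- **`ĥ(2) = ĥ(0) = ∫ h` ON `U(2,1)_{L∕L⁺}`** — K2E4-p10's (RES) letter `hsym` (★ p859418: `Λ_g 𝟙 = a 2` with `a = ĥ`, `Λ_g 𝟙 = ∫ h`): `∫ h(x)·H(x)^2 dν_G = ∫ h dν_G` for left-`K`-invariant `h ∈ C_c(G(𝔸))`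
(§3 at `z = 2`, `H^0 = 1`). [cite: MoeglinWaldspurger1995, II.1.7 and IV.1.11] [cite: Langlands1976, §7] -/
theorem integral_mul_borelHeight_sq_eq_integral_cm_three (νG : Measure (quasiSplit (↥(maximalRealSubfield L)) L (IsCMField.complexConj L) 3).Adelic) [νG.IsHaarMeasure]
    {h : (quasiSplit (↥(maximalRealSubfield L)) L (IsCMField.complexConj L) 3).Adelic → ℂ}
    (hK : ∀ k : (quasiSplit (↥(maximalRealSubfield L)) L (IsCMField.complexConj L) 3).Adelic,
      adelicVal (↥(maximalRealSubfield L)) L (IsCMField.complexConj L) 3 ((StdForm.antidiagonal 3).over L) k ∈ standardMaximalCompactGL 3 L → ∀ x, h (k * x) = h x)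
    (hh : Continuous h) (hhs : HasCompactSupport h) :
    ∫ x, h x * (((borelHeight x : ℝ≥0) : ℝ) : ℂ) ^ (2 : ℂ) ∂νG = ∫ x, h x ∂νG := by
  rw [sphericalTransform_symm_cm_three L νG hK hh hhs 2, sub_self]
  simp only [Complex.cpow_zero, mul_one]

end CMThree

end Summit.HodgeConjecture.HodgeConjecture.Cruxes.H413.K2E1SphericalTransformSymmetryU

end
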